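import Mathlib
import Summits.KontsevichZagierPeriods.Zeta5Search.ModPDigit
import Summits.KontsevichZagierPeriods.Zeta5Search.RecordAtlasCells
import HarnessLib

/-!
# ζ(5) search — the RESIDUE IDENTITY of `R_b mod p` and the TYPE-SPACE LAW (second-order digits of the contiguity Casoratian), statement layer (gen-2 g11)

HONEST FRAMING: systematic search; no irrationality claim unless certified.

Cell `pub-zeta5`, ideation seat gen-2, generation 11 (`HOME/pub-zeta5-gen-2/REPORT-gen2-g11.md`).  STATEMENTS ONLY (`@[conjecture] def … : Prop`);
§1 is an elementary finite-field identity (residue theorem on `P¹(F_p)`, PROVED on paper, REPORT §2) and the natural first P-seat target; §2 is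
PROVED on paper (REPORT §4) from the tree theorems `secondDigitW_holds` / `secondDigitV_holds` (gen-2 g10's (W2)/(V2)), the conjugation rules of
`SecondOrderPair`, and §1; §3 are the record-ray window statements that follow from §2 and a cell-uniform class-structure lemma (REPORT §5;
structural scan of every prime of each window for n ≤ 60: 0 exceptions; exact instances listed per cell).  Exact checks: `g11/lawW.py random`
(two seeds, 18,728 instances in the setting, 4,279 satisfying the hypotheses of §2: 0 failures; every hypothesis shown necessary by instances).
Nothing here bears on irrationality: these are `p`-adic digits of the partial-fraction data of the Brown–Zudilin rational function `R_b`.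

INCREMENT over `ModPDigit.lean` (`gBar`, `phiBar`, `sBar`, `LawR4`) and `SecondOrderDigit.lean` (`tauW`, `tauV`, `orbitW`, `orbitV`,
`SecondOrderCollinearity`); nothing is redeclared.  KEY NEW FACT (REPORT §2): with `R̄ = ∏_{y ∈ F_p}(t+y)^{E_y}`, `D = t^p − t` and any
`h ∈ F_p[t]`, the rational function `h·R̄·D^{M−2}` (`E_y ≥ −M` for all `y`) has poles only at the points `−x` with `E_x ∈ {−M, −M+1}`, of order
`≤ 2`, with residues `(hG_x)'(−x)` resp. `(hG_x)(−x)` (`G_x = R̄·(t+x)^{−E_x}`; Wilson: `(D/(t+x))(−x) = −1`, `(D/(t+x))'(−x) = 0`), so the residue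
theorem gives `Σ_{E_x=−M} (h'ḡ_x + hḡ_xφ̄_x)(−x) + Σ_{E_x=−M+1} (hḡ_x)(−x) = 0` as soon as `deg h + p(M−2) + Σ_y E_y ≤ −2` ("DEG").  With `h = 1`
this is `sBar b p M = 0` (gen-2 g10's open "moment-triangle law", now a theorem in the DEG range); with `h = (t + b₀/2)²` it is the identity that
controls the `Q`-TWIST `R_{b+e_j} = R_b·((t+c)² − δ_j²)`, through which `Cas_j = W[R_bQ]·V[R_b] − W[R_b]·V[R_bQ]` for every `j` (REPORT §3).
Consequence (TYPE-SPACE LAW, REPORT §4): the two second-order aggregate vectors of `b` and of its `Q`-twist both lie in the TYPE SPACE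
`𝒲 = {Σ_o c_o D_o : Σ_o c_o |o| = 0}` spanned by the orbit type-vectors, so ZERO regime ∧ `dim 𝒲 ≤ 1` ∧ DEG ⇒ `v_p(Cas_j) ≥ casLB + 3`, and
ORIGIN regime ∧ `𝒲 ⊆ F_p·P₁` ∧ DEG ⇒ `v_p(Cas_j) ≥ casLB + 2`.  On the record ray the DEG inequality `p(M−2) ≤ 50n + 1` is EXACTLY the right
end-point `θ = 50/(M−2)` of the seven census-g18 gap windows `(6,25/4) (14/3,5) (41/5,25/3) (3,25/8) (2,25/12) (41/10,25/6) (17/9,25/13)`.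
-/

open Finset Polynomial

namespace Summit.KontsevichZagierPeriods.Zeta5Search.ResidueLaw

open Summit.KontsevichZagierPeriods.Zeta5Search.ClusterValuation
open Summit.KontsevichZagierPeriods.Zeta5Search.CasoratianValuation (InPolytope shift casoratian)
open Summit.KontsevichZagierPeriods.Zeta5Search.SecondOrder (gBar phiBar sBar tauW tauV orbitW orbitV wHat2 vHat2 classTypeList)

/-! ## §1 The residue identity (REPORT-gen2-g11 §2; PROVED on paper — residue theorem on `P¹(F_p)` + Wilson) -/

/-- `ḡ_x(E) := ∏_{y ≠ x, y < p} (y − x)^{E_y} ∈ ZMod p` for an arbitrary exponent vector `E` on the residues (`gBar b p x = 2·ḡ_x(classExp b p)`). -/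
def gBarE (p : ℕ) (E : ℕ → ℤ) (x : ℕ) : ZMod p :=
  (∏ y ∈ (range p).erase x, ((y : ZMod p) - (x : ZMod p)) ^ (max (E y) 0).toNat)
    * (∏ y ∈ (range p).erase x, ((y : ZMod p) - (x : ZMod p)) ^ (max (-E y) 0).toNat)⁻¹

/-- `φ̄_x(E) := Σ_{y ≠ x, y < p} E_y·(y − x)⁻¹ ∈ ZMod p` (`phiBar b p x = φ̄_x(classExp b p)`). -/
def phiBarE (p : ℕ) (E : ℕ → ℤ) (x : ℕ) : ZMod p :=
  ∑ y ∈ (range p).erase x, ((E y : ℤ) : ZMod p) * (((y : ZMod p) - (x : ZMod p)))⁻¹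

/-- **RESIDUE IDENTITY (abstract form).**  `p ≥ 3` prime, `M ≥ 2`, `E : F_p → ℤ` with `E_y ≥ −M` for every residue `y`, `h ∈ F_p[t]` with
`deg h + p(M−2) + Σ_y E_y ≤ −2`.  Then `Σ_{E_x = −M} (h'(−x)·ḡ_x + h(−x)·ḡ_x·φ̄_x) + Σ_{E_x = −M+1} h(−x)·ḡ_x = 0` in `ZMod p`.
(Proof: residues of `h·∏_y(t+y)^{E_y}·(t^p−t)^{M−2}` at the points `t = −x`, which are its only poles, of order `≤ 2`; `deg ≤ −2` kills `∞`.) -/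
@[conjecture] def ResidueIdentity : Prop :=
  ∀ (p M : ℕ) (E : ℕ → ℤ) (h : Polynomial (ZMod p)), p.Prime → 3 ≤ p → 2 ≤ M → (∀ x, x < p → -(M : ℤ) ≤ E x) →
    (h.natDegree : ℤ) + (p : ℤ) * ((M : ℤ) - 2) + ∑ x ∈ range p, E x ≤ -2 →
    (∑ x ∈ (range p).filter (fun x => E x = -(M : ℤ)),
        ((derivative h).eval (-(x : ZMod p)) * gBarE p E x + h.eval (-(x : ZMod p)) * gBarE p E x * phiBarE p E x))
      + (∑ x ∈ (range p).filter (fun x => E x = -(M : ℤ) + 1), h.eval (-(x : ZMod p)) * gBarE p E x) = 0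

/-- `ā_x := b₀/2 − x ∈ ZMod p`: the (reduced) distance from the class base to the centre of `R_b` (`= 0` iff `CentreIn`). -/
def aBar (b : ℕ → ℤ) (p x : ℕ) : ZMod p := ((b 0 : ℤ) : ZMod p) * (2 : ZMod p)⁻¹ - (x : ZMod p)

/-- The `h = (t + b₀/2)²` residue sum `Σ_{E_x=−M} (2ā_xḡ_x + ā_x²ḡ_xφ̄_x) + Σ_{E_x=−M+1} ā_x²ḡ_x` (the `h = 1` sum is `sBar` up to the
single-class convention, see `ResidueIdentityB`). -/
def sBar2 (b : ℕ → ℤ) (p M : ℕ) : ZMod p :=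
  (∑ x ∈ (range p).filter (fun x => classExp b p x = -(M : ℤ)),
      (2 * aBar b p x * gBar b p x + aBar b p x ^ 2 * gBar b p x * phiBar b p x))
    + ∑ x ∈ (range p).filter (fun x => classExp b p x = -(M : ℤ) + 1), aBar b p x ^ 2 * gBar b p x

/-- **RESIDUE IDENTITY for `R_b`** (the two instances used by the type-space law; `E := classExp b p`, `Σ_x E_x = deg R_b = −2d − 5`,
`d = 3b₀ − Σ_{i≥1} b_i`): if every pole class has `E_x ≥ −M` then
`p(M−2) ≤ 2d + 3 ⇒ Σ_{E=−M} ḡφ̄ + Σ_{E=−M+1} ḡ = 0` and `p(M−2) ≤ 2d + 1 ⇒ sBar2 b p M = 0`. -/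
@[conjecture] def ResidueIdentityB : Prop :=
  ∀ (b : ℕ → ℤ) (p M : ℕ), InPolytope b → p.Prime → 5 ≤ p → (p : ℤ) ≤ b 0 → 2 ≤ M →
    (∀ x, x < p → 1 ≤ classPoleCount b p x → -(M : ℤ) ≤ classExp b p x) →
    ((p : ℤ) * ((M : ℤ) - 2) + ∑ x ∈ range p, classExp b p x ≤ -2 →
      (∑ x ∈ (range p).filter (fun x => classExp b p x = -(M : ℤ)), gBar b p x * phiBar b p x)
        + (∑ x ∈ (range p).filter (fun x => classExp b p x = -(M : ℤ) + 1), gBar b p x) = 0) ∧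
    ((p : ℤ) * ((M : ℤ) - 2) + ∑ x ∈ range p, classExp b p x ≤ -4 → sBar2 b p M = 0)

/-! ## §2 The type-space law (REPORT-gen2-g11 §4; PROVED on paper from `secondDigitW/V_holds`, `SecondOrderPair` and §1)

Live classes: pole classes with `E_x ∈ {−M, −M+1}` (`M ≥ 6` even, every pole class `E ≥ −M`).  DOUBLED ORBIT POINTS (`2·D_o/|o|` of the REPORT):
deep class `x` (`E = −M`, never self-conjugate): `τ_x + τ_x̄`; sub-deep conjugate pair `{y, ȳ}`: `2(σ_y + σ_ȳ)` (`σ = (ŵ, v̂)`, each class with its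
own base; `= 2·(orbitW, orbitV)`); self-conjugate sub-deep class: `4σ_y`.  ZERO regime: every deep type list is a palindrome (then the exact
first-order orbit vectors `σ_x − σ_x̄` vanish, `PalindromicVDigits`).  ORIGIN regime: the exact vectors `σ_x − σ_x̄` (deep `x`) are all rational
multiples of one primitive integer vector `u`.  DEG: `p(M−2) + Σ_x E_x ≤ −4` (i.e. `p(M−2) ≤ 2d+1`). -/

/-- First coordinate of the doubled orbit point of a live class. -/
noncomputable def pointW (b : ℕ → ℤ) (p M x : ℕ) : ℚ :=
  if classExp b p x = -(M : ℤ) then tauW b p x + tauW b p (conjClass b p x)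
  else if CentreIn b p x then 4 * wHat b p x else 2 * orbitW b p x

/-- Second coordinate of the doubled orbit point of a live class. -/
noncomputable def pointV (b : ℕ → ℤ) (p M x : ℕ) : ℚ :=
  if classExp b p x = -(M : ℤ) then tauV b p x + tauV b p (conjClass b p x)
  else if CentreIn b p x then 4 * vHat b p x else 2 * orbitV b p x

/-- The live classes: pole classes of exponent `−M` or `−M+1`. -/
def liveClasses (b : ℕ → ℤ) (p M : ℕ) : Finset ℕ :=
  (range p).filter fun x => 1 ≤ classPoleCount b p x ∧ (classExp b p x = -(M : ℤ) ∨ classExp b p x = -(M : ℤ) + 1)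

/-- Affine cross product of three doubled orbit points: `det(P_y − P_x, P_z − P_x)`. -/
noncomputable def affDet (b : ℕ → ℤ) (p M x y z : ℕ) : ℚ :=
  (pointW b p M y - pointW b p M x) * (pointV b p M z - pointV b p M x)
    - (pointV b p M y - pointV b p M x) * (pointW b p M z - pointW b p M x)

/-- `det(u, P_y − P_x)` for a direction `u ∈ ℤ²`. -/
noncomputable def dirDet (b : ℕ → ℤ) (p M : ℕ) (u : ℤ × ℤ) (x y : ℕ) : ℚ :=
  (u.1 : ℚ) * (pointV b p M y - pointV b p M x) - (u.2 : ℚ) * (pointW b p M y - pointW b p M x)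

/-- **TYPE-SPACE LAW, ZERO REGIME (`casLB + 3`).**  Window prime `5 ≤ p ≤ b₀ < p² − 2`, `M ≥ 6` even, every pole class `E ≥ −M`, every class
of exponent `−M` non-self-conjugate with palindromic type list, DEG, and the orbit points AFFINELY COLLINEAR mod `p`.  Then
`v_p(Cas_j(b)) ≥ 6 − 2M` for every admissible direction `j`.  (`LawA3` / `SecondOrderCollinearity` are the sub-case "points on a line through 0";
the record zero windows are NOT in that sub-case.) -/
@[conjecture] def TypeSpaceLawZero : Prop :=
  ∀ (b : ℕ → ℤ) (p j M : ℕ), InPolytope b → InPolytope (shift b j) → 1 ≤ j → j ≤ 7 → p.Prime → 5 ≤ p → (p : ℤ) ≤ b 0 →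
    (b 0 + 2 : ℤ) < (p : ℤ) ^ 2 → 6 ≤ M → Even M →
    (∀ x, x < p → 1 ≤ classPoleCount b p x → -(M : ℤ) ≤ classExp b p x) →
    (∀ x, x < p → 1 ≤ classPoleCount b p x → classExp b p x = -(M : ℤ) →
        ¬ CentreIn b p x ∧ (classTypeList b p x).reverse = classTypeList b p x) →
    (p : ℤ) * ((M : ℤ) - 2) + ∑ x ∈ range p, classExp b p x ≤ -4 →
    (∀ x ∈ liveClasses b p M, ∀ y ∈ liveClasses b p M, ∀ z ∈ liveClasses b p M,
        affDet b p M x y z = 0 ∨ 1 ≤ padicValRat p (affDet b p M x y z)) →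
    casoratian b j ≠ 0 → (6 : ℤ) - 2 * M ≤ padicValRat p (casoratian b j)

/-- **TYPE-SPACE LAW, ZERO REGIME, ONE POINT (`casLB + 4`).**  As `TypeSpaceLawZero` but all orbit points EQUAL mod `p` (type space `𝒲 = 0`):
then both second-order aggregate vectors vanish and `v_p(Cas_j(b)) ≥ 7 − 2M` (exact census: 553 instances, minimum excess exactly 4). -/
@[conjecture] def TypeSpaceLawZeroPoint : Prop :=
  ∀ (b : ℕ → ℤ) (p j M : ℕ), InPolytope b → InPolytope (shift b j) → 1 ≤ j → j ≤ 7 → p.Prime → 5 ≤ p → (p : ℤ) ≤ b 0 →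
    (b 0 + 2 : ℤ) < (p : ℤ) ^ 2 → 6 ≤ M → Even M →
    (∀ x, x < p → 1 ≤ classPoleCount b p x → -(M : ℤ) ≤ classExp b p x) →
    (∀ x, x < p → 1 ≤ classPoleCount b p x → classExp b p x = -(M : ℤ) →
        ¬ CentreIn b p x ∧ (classTypeList b p x).reverse = classTypeList b p x) →
    (p : ℤ) * ((M : ℤ) - 2) + ∑ x ∈ range p, classExp b p x ≤ -4 →
    (∀ x ∈ liveClasses b p M, ∀ y ∈ liveClasses b p M,
        (pointW b p M y - pointW b p M x = 0 ∨ 1 ≤ padicValRat p (pointW b p M y - pointW b p M x)) ∧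
        (pointV b p M y - pointV b p M x = 0 ∨ 1 ≤ padicValRat p (pointV b p M y - pointV b p M x))) →
    casoratian b j ≠ 0 → (7 : ℤ) - 2 * M ≤ padicValRat p (casoratian b j)

/-- **TYPE-SPACE LAW, ORIGIN REGIME (`casLB + 2`).**  Window prime, `M ≥ 6` even, every pole class `E ≥ −M`, classes of exponent `−M`
non-self-conjugate; a primitive direction `u ∈ ℤ²` (not `≡ 0 mod p`) such that every exact deep first-order orbit vector
`σ_x − σ_x̄ = (ŵ_x − ŵ_x̄, v̂_x − v̂_x̄)` is a rational multiple of `u`, DEG, and all differences of orbit points parallel to `u` mod `p`.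
Then `v_p(Cas_j(b)) ≥ 5 − 2M`. -/
@[conjecture] def TypeSpaceLawOrigin : Prop :=
  ∀ (b : ℕ → ℤ) (p j M : ℕ) (u : ℤ × ℤ), InPolytope b → InPolytope (shift b j) → 1 ≤ j → j ≤ 7 → p.Prime → 5 ≤ p → (p : ℤ) ≤ b 0 →
    (b 0 + 2 : ℤ) < (p : ℤ) ^ 2 → 6 ≤ M → Even M → ¬ ((p : ℤ) ∣ u.1 ∧ (p : ℤ) ∣ u.2) →
    (∀ x, x < p → 1 ≤ classPoleCount b p x → -(M : ℤ) ≤ classExp b p x) →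
    (∀ x, x < p → 1 ≤ classPoleCount b p x → classExp b p x = -(M : ℤ) →
        ¬ CentreIn b p x ∧
        (u.1 : ℚ) * (vHat b p x - vHat b p (conjClass b p x)) - (u.2 : ℚ) * (wHat b p x - wHat b p (conjClass b p x)) = 0) →
    (p : ℤ) * ((M : ℤ) - 2) + ∑ x ∈ range p, classExp b p x ≤ -4 →
    (∀ x ∈ liveClasses b p M, ∀ y ∈ liveClasses b p M,
        dirDet b p M u x y = 0 ∨ 1 ≤ padicValRat p (dirDet b p M u x y)) →
    casoratian b j ≠ 0 → (5 : ℤ) - 2 * M ≤ padicValRat p (casoratian b j)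

/-! ## §3 The record-ray windows (REPORT-gen2-g11 §5): `b(n) = bRec n`, `Cas₇`, `θ = p/n`; DEG edge `θ = 50/(M−2)`

| window (θ) | integer form | regime | M | casLB | tree/first-digit bound | NEW bound | law | exact instances (n,p): v |
|---|---|---|---|---|---|---|---|---|
| (6, 25/4) | 6n < p, 4p < 25n | zero | 10 | −17 | −15 (`RecordCellL`) | −14 | Zero (+3) | (5,31) (6,37) (7,43) (10,61) (11,67) (16,97): −14 |
| (14/3, 5) | 14n < 3p, p < 5n | origin | 12 | −21 | −20 (`RecordCellI`) | −19 | Origin (+2) | (4,19) (6,29) (9,43) (10,47) (11,53) (12,59) (13,61): −19 |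
| [41/5+3/(5n), 25/3) | 41n+3 ≤ 5p, 3p < 25n | zero | 8 | −13 | −11 (`RecordCellN`) | −10 | Zero (+3) | (10,83): −10 |
| (3, 25/8) | 3n < p, 8p < 25n | zero | 18 | −33 | −31 (g9 atlas) | −30 | Zero (+3) | (10,31) (17,53): −30 |
| (2, 25/12) | 2n < p, 12p < 25n | zero | 26 | −49 | −47 (g9 atlas) | −46 | Zero (+3) | (15,31) (20,41): −46 |
| [41/10+3/(10n), 25/6) | 41n+3 ≤ 10p, 6p < 25n | zero | 14 | −25 | −23 (`RecordCellH`) | −22 | Zero (+3) | (7,29): −22 |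
| (17/9, 25/13) | 17n < 9p, 13p < 25n | origin | 28 | −53 | −52 (g9 atlas) | −51 | Origin (+2) | (12,23): −51, (10,19): −50 (p² < b₀+2) |

Boundary layers (structure of the neighbouring cell, `M` odd): `5p − 41n ∈ {1,2}` has `m = −7` and `v = −10` at (13,107), (24,197);
`10p − 41n ∈ {1,2}` has `m = −13` and `v = −21` at (9,37).  Structural scan (`g11/lawW_light.py window`): every prime of every window with
`n ≤ 60` (`≤ 80` for the `M = 14` window) satisfies the hypotheses of the corresponding law (361 instances, 0 exceptions). -/

/-- **RECORD WINDOW M = 10** (`6 < θ < 25/4`; zero, casLB = −17; sharpens `RecordCellL`'s −15 below the DEG edge): `v_p(Cas₇(b(n))) ≥ −14`. -/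
@[conjecture] def RecWindowM10 : Prop :=
  ∀ n p : ℕ, 2 ≤ n → p.Prime → 6 * n < p → 4 * p < 25 * n → casoratian (bRec n) 7 ≠ 0 →
    (-14 : ℤ) ≤ padicValRat p (casoratian (bRec n) 7)

/-- **RECORD WINDOW M = 12** (`14/3 < θ < 5`; origin, casLB = −21; sharpens `RecordCellI`'s −20 on this sub-window): `v_p(Cas₇(b(n))) ≥ −19`. -/
@[conjecture] def RecWindowM12 : Prop :=
  ∀ n p : ℕ, 2 ≤ n → p.Prime → 14 * n < 3 * p → p < 5 * n → casoratian (bRec n) 7 ≠ 0 →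
    (-19 : ℤ) ≤ padicValRat p (casoratian (bRec n) 7)

/-- **RECORD WINDOW M = 8** (`41n + 3 ≤ 5p`, `θ < 25/3`; zero, casLB = −13; sharpens `RecordCellN`'s −11): `v_p(Cas₇(b(n))) ≥ −10`. -/
@[conjecture] def RecWindowM8 : Prop :=
  ∀ n p : ℕ, 2 ≤ n → p.Prime → 41 * n + 3 ≤ 5 * p → 3 * p < 25 * n → casoratian (bRec n) 7 ≠ 0 →
    (-10 : ℤ) ≤ padicValRat p (casoratian (bRec n) 7)

/-- Boundary layer of the `M = 8` window (`5p − 41n ∈ {1,2}`: the multipole minimum is `−7`, the structure of cell M): `v_p ≥ −10`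
OBSERVED at the two computed instances (13,107), (24,197) (both `= −10`); not covered by the type-space law. -/
@[conjecture] def RecWindowM8Layer : Prop :=
  ∀ n p : ℕ, 2 ≤ n → p.Prime → 41 * n < 5 * p → 5 * p ≤ 41 * n + 2 → casoratian (bRec n) 7 ≠ 0 →
    (-10 : ℤ) ≤ padicValRat p (casoratian (bRec n) 7)

/-- **RECORD WINDOW M = 18** (`3 < θ < 25/8`; zero, casLB = −33): `v_p(Cas₇(b(n))) ≥ −30`. -/
@[conjecture] def RecWindowM18 : Prop :=
  ∀ n p : ℕ, 2 ≤ n → p.Prime → 3 * n < p → 8 * p < 25 * n → casoratian (bRec n) 7 ≠ 0 →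
    (-30 : ℤ) ≤ padicValRat p (casoratian (bRec n) 7)

/-- **RECORD WINDOW M = 26** (`2 < θ < 25/12`; zero with TWO palindromic deep types, casLB = −49): `v_p(Cas₇(b(n))) ≥ −46`. -/
@[conjecture] def RecWindowM26 : Prop :=
  ∀ n p : ℕ, 2 ≤ n → p.Prime → 2 * n < p → 12 * p < 25 * n → casoratian (bRec n) 7 ≠ 0 →
    (-46 : ℤ) ≤ padicValRat p (casoratian (bRec n) 7)

/-- **RECORD WINDOW M = 14** (`41n + 3 ≤ 10p`, `θ < 25/6`; zero, casLB = −25; sharpens `RecordCellH`'s −23): `v_p(Cas₇(b(n))) ≥ −22`. -/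
@[conjecture] def RecWindowM14 : Prop :=
  ∀ n p : ℕ, 2 ≤ n → p.Prime → 41 * n + 3 ≤ 10 * p → 6 * p < 25 * n → casoratian (bRec n) 7 ≠ 0 →
    (-22 : ℤ) ≤ padicValRat p (casoratian (bRec n) 7)

/-- Boundary layer of the `M = 14` window (`10p − 41n ∈ {1,2}`: multipole minimum `−13`, the structure of cell G): `v_p ≥ −22` (OBSERVED `−21`
at the computed instance (9,37)); not covered by the type-space law. -/
@[conjecture] def RecWindowM14Layer : Prop :=
  ∀ n p : ℕ, 2 ≤ n → p.Prime → 41 * n < 10 * p → 10 * p ≤ 41 * n + 2 → casoratian (bRec n) 7 ≠ 0 →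
    (-22 : ℤ) ≤ padicValRat p (casoratian (bRec n) 7)

/-- **RECORD WINDOW M = 28** (`17/9 < θ < 25/13`, window primes `p² > 41n + 2`; origin, casLB = −53): `v_p(Cas₇(b(n))) ≥ −51`
(the one non-window prime instance of the θ-range, (10,19), has `v = −50`). -/
@[conjecture] def RecWindowM28 : Prop :=
  ∀ n p : ℕ, 2 ≤ n → p.Prime → 17 * n < 9 * p → 13 * p < 25 * n → 41 * n + 2 < p ^ 2 → casoratian (bRec n) 7 ≠ 0 →
    (-51 : ℤ) ≤ padicValRat p (casoratian (bRec n) 7)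

end Summit.KontsevichZagierPeriods.Zeta5Search.ResidueLaw
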